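import Literature.AlgebraicGeometry.HodgeTheory.HyperplaneSectionRationalMonodromy
import Literature.AlgebraicGeometry.HodgeTheory.LocallyTrivialExtensionClasses
import Summits.HodgeConjecture.HodgeConjecture.Theorems.LinearSystemTorelliLocalTubeSpanBaseChange
import Summits.HodgeConjecture.HodgeConjecture.Theorems.LinearSystemTorelliLocalTubeSpanRatTensorEquiv
import Summits.HodgeConjecture.HodgeConjecture.Theorems.LinearSystemTorelliLocalTubeSpanAlgebra
import Summits.HodgeConjecture.HodgeConjecture.Theorems.LinearSystemTorelliLocalTubeSpanOneViewPoint
import Summits.HodgeConjecture.HodgeConjecture.Theorems.LinearSystemTorelliLocalTubeSpanNCNodal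
import Summits.HodgeConjecture.HodgeConjecture.Theorems.LinearSystemTorelliLocalTubeSpanLocalKernelOfBalls

/-!
# Route LinearSystemTorelli — crux `LocalTubeSpan` (stmt-HodgeConjecture-2490): typed assembly on the hyperplane-section package

Helper file (`--supports stmt-HodgeConjecture-2490`, line `Sketch` of the crux chain, cycle 5
"assembly on the tree's hyperplane-section package", compositions by the lead).

The crux ("local Schnell theorem", C. Schnell, *Primitive cohomology and the tube mapping*, Math. Z.
268 (2010) §3, §7; P. Brosnan, H. Fang, Z. Nie, G. Pearlstein, *Singularities of admissible normal
functions*, Invent. Math. 177 (2009) §1) is informal in the route file; its c-free typed shape over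
the tree's vocabulary (`Literature/AlgebraicGeometry/HodgeTheory/LocallyTrivialExtensionClasses`:
`monodromyRepObj`, `localSubgroup`, `localKernelOn`, `localKernel`, `evalCoinvOn`, `H1resKer`) is
"the classes of `H¹(π₁(U, s), V_s)` undetected by every element of the local subgroups at a small
neighbourhood `N` of `t₀ ∈ Δ` are exactly `localKernelOn N`" (candidates `LocalTubeSpanCFree(Balls)`
of the crux workfile `Lines/SketchTypedCandidate.lean`).  The line proved cyclic detection over `ℚ`
for the relevant Picard–Lefschetz configurations and, in cycle 4, its portability (base change along
a finite-dimensional `ℚ`-form, one view point, balls ⇒ colimit).  Cycle 5 constructed the `ℚ`-form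
on the tree's real objects — the rational monodromy `DirectImageLocalSystem.ratMonodromy D k s` of
`Rᵏ π_* ℂ|_U` on `Hᵏ(X_s(ℂ); ℚ)` (Literature file `HodgeTheory/HyperplaneSectionRationalMonodromy`)
with its intertwining tensor equivalence (`localTubeSpan_ratTensorEquiv`).  This file ASSEMBLES:

* `localTubeSpan_injective_evalCoinv_res_iff_rat` — for every subgroup `S ≤ π₁(U, s)`, cyclic
  detection for the restriction to `S` of `monodromyRepObj (D.V k) s` (over `ℂ`) ⇔ for the
  restriction of the rational monodromy (over `ℚ`);
* `localTubeSpan_ker_evalCoinvOn_eq_H1resKer_of_rat` — hence the typed SURROGATE at `S`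
  (`ker (evalCoinvOn _ S) = H1resKer _ S`) from `ℚ`-cyclic detection at `S`;
* `localTubeSpan_localKernelOn_eq_iInf_ker_of_rat` — at a path-connected piece `ι⁻¹ N`, the typed
  statement `localKernelOn ι (D.V k) s N = ⨅_{view points} ker evalCoinvOn` from `ℚ`-cyclic
  detection at ONE local subgroup;
* `localTubeSpan_localKernelOn_eq_iInf_ker_of_ncNodal` — the NORMAL-CROSSING NODAL instance,
  UNCONDITIONALLY: if one local subgroup at `N` is generated by finitely many elements acting on
  `Hᵏ(X_s(ℂ); ℚ)` as Picard–Lefschetz transvections `x ↦ x - B(x, δᵢ) δᵢ` along mutually orthogonal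
  non-zero cycles for a nondegenerate form `B` (the geometric presentation at an NC-nodal member:
  local `π₁ = ℤʳ` of meridians, Picard–Lefschetz formula, disjoint vanishing spheres), then the
  typed statement holds at `N`;
* `localTubeSpan_mem_localKernel_of_rat_balls` — the colimit form at `t₀` (`localKernel`) from
  `ℚ`-cyclic detection at the local subgroups of all small open balls;
* (companion file `…TypedAssemblyVanishing`: the same three statements for the VANISHING
  sub-local system `D.vanishingLocalSystem μ hX hb` of a `HyperplaneSectionLocalSystem` — the
  carrier of the crux's typed candidates — given the Lefschetz splitting
  `Hⁿ(X_s) = Hⁿ(X_s)_van ⊕ i^*Hⁿ(X)` as the hypothesis `IsCompl`, via `localTubeSpan_vanishingTransfer`.)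

What remains for a typed crux is GEOMETRIC (the presentation of one local subgroup as a transvection
configuration of a covered type) and, off the unconditional types, the named facts
`Schnell2010_lemma11` / `Janssen1983_thm2_9`.  No named facts are used in this file; no `sorry`.
-/

-- `Summit.HodgeConjecture.HodgeConjecture.Theorems` is the mandated namespace (single-conjunct summit:
-- Sub = Summit), which `linter.dupNamespace` flags on every declaration; the lakefile turns the
-- linter off tree-wide (weak option), restated here so stand-alone elaboration is warning-free too.
set_option linter.dupNamespace false

noncomputable section

open CategoryTheory groupCohomology
open _root_.Topology Filter
open Literature.AlgebraicGeometry Literature.AlgebraicGeometry.HodgeTheory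
open Literature.AlgebraicTopology.SingularHomology
open scoped TensorProduct

namespace Summit.HodgeConjecture.HodgeConjecture.Theorems

universe v

variable {𝒳 Sb : Motives.SchemeOver ℂ} {π : 𝒳 ⟶ Sb} {n : ℕ}

/-- **Cyclic detection over `ℂ` ⇔ over `ℚ` at a subgroup.**  For `S ≤ π₁(U, s)`, Schnell's third
map of the restriction to `S` of the monodromy representation `monodromyRepObj (D.V k) s` of
`Rᵏ π_* ℂ|_U` is injective iff that of the restriction of the rational monodromy
`D.ratMonodromy k s` is (`localTubeSpan_injective_evalCoinv_iff_of_tensorEquiv` with the intertwining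
`ofRatClassBaseChangeEquiv ≫ fiberIso⁻¹` of `localTubeSpan_ratTensorEquiv`). -/
theorem localTubeSpan_injective_evalCoinv_res_iff_rat (D : DirectImageLocalSystem π n) (k : ℕ)
    (s : smoothFiberLocus π n) (S : Subgroup (FundamentalGroup (smoothFiberLocus π n) s)) :
    Function.Injective (evalCoinv (Rep.res S.subtype (Rep.of (D.ratMonodromy k s)))) ↔
      Function.Injective (evalCoinv (Rep.res S.subtype (monodromyRepObj (D.V k) s))) := by
  obtain ⟨hfd, he⟩ :=
    localTubeSpan_ratTensorEquiv D k s (D.ratMonodromy k s) (D.ofRatClass_ratMonodromy k s)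
  haveI : FiniteDimensional ℚ (Rep.res S.subtype (Rep.of (D.ratMonodromy k s))).V := hfd
  exact localTubeSpan_injective_evalCoinv_iff_of_tensorEquiv
    (Rep.res S.subtype (Rep.of (D.ratMonodromy k s))) (Rep.res S.subtype (monodromyRepObj (D.V k) s))
    ((ofRatClassBaseChangeEquiv s.2 k).trans (D.fiberIso k s).symm) fun g c x => he g c x

/-- **The typed surrogate at a subgroup from `ℚ`-cyclic detection**: if Schnell's third map of the
rational monodromy restricted to `S ≤ π₁(U, s)` is injective, then the classes of
`H¹(π₁(U, s), (V k)_s)` undetected by every element of `S` are exactly those restricting to zero on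
`S`. -/
theorem localTubeSpan_ker_evalCoinvOn_eq_H1resKer_of_rat (D : DirectImageLocalSystem π n) (k : ℕ)
    (s : smoothFiberLocus π n) (S : Subgroup (FundamentalGroup (smoothFiberLocus π n) s))
    (hinj : Function.Injective (evalCoinv (Rep.res S.subtype (Rep.of (D.ratMonodromy k s))))) :
    LinearMap.ker (evalCoinvOn (monodromyRepObj (D.V k) s) S) =
      H1resKer (monodromyRepObj (D.V k) s) S :=
  localTubeSpan_ker_evalCoinvOn_eq_H1resKer_of_injective _ S
    ((localTubeSpan_injective_evalCoinv_res_iff_rat D k s S).1 hinj)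

variable {T : Type v} [TopologicalSpace T]

/-- **The typed statement at a path-connected piece from ONE view point.**  For a continuous
`ι : U → T` (the inclusion of the smooth-fibre locus into `S(ℂ)`), a subset `N ⊆ T` with `ι⁻¹ N`
path connected, and one view point `s'`, `γ`: if Schnell's third map of the rational monodromy
restricted to the local subgroup `localSubgroup ι s N hs' γ` is injective, then the tree's
`localKernelOn ι (D.V k) s N` (classes restricting to zero on ALL local subgroups at `N`) is exactly
the space of classes undetected on all of them — the c-free local Schnell statement at `N`. -/
theorem localTubeSpan_localKernelOn_eq_iInf_ker_of_rat (ι : C(smoothFiberLocus π n, T))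
    (D : DirectImageLocalSystem π n) (k : ℕ) (s : smoothFiberLocus π n) (N : Set T)
    (hN : IsPathConnected (ι ⁻¹' N)) {s' : smoothFiberLocus π n} (hs' : ι s' ∈ N) (γ : Path s' s)
    (hinj : Function.Injective
      (evalCoinv (Rep.res (localSubgroup ι s N hs' γ).subtype (Rep.of (D.ratMonodromy k s))))) :
    localKernelOn ι (D.V k) s N =
      ⨅ (s₂ : smoothFiberLocus π n) (hs₂ : ι s₂ ∈ N) (γ₂ : Path s₂ s),
        LinearMap.ker (evalCoinvOn (monodromyRepObj (D.V k) s) (localSubgroup ι s N hs₂ γ₂)) :=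
  localTubeSpan_localKernelOn_eq_iInf_ker_of_one ι (D.V k) s N hN hs' γ
    (localTubeSpan_ker_evalCoinvOn_eq_H1resKer_of_rat D k s _ hinj)

/-- **The normal-crossing nodal instance, unconditionally.**  If ONE local subgroup at the
path-connected piece `N` is generated by finitely many elements `tᵢ` acting on `Hᵏ(X_s(ℂ); ℚ)`
(through the rational monodromy) as the Picard–Lefschetz transvections `x ↦ x - B(x, δᵢ) δᵢ` along
mutually orthogonal non-zero cycles `δᵢ` of a nondegenerate form `B` — the presentation at a
normal-crossing nodal member (local fundamental group `ℤʳ` of the meridians, Picard–Lefschetz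
formula, pairwise disjoint vanishing spheres) — then `localKernelOn ι (D.V k) s N` is exactly the
space of classes undetected on all local subgroups at `N` (`…NCNodal`: rank-drop words, no named
fact). -/
theorem localTubeSpan_localKernelOn_eq_iInf_ker_of_ncNodal (ι : C(smoothFiberLocus π n, T))
    (D : DirectImageLocalSystem π n) (k : ℕ) (s : smoothFiberLocus π n) (N : Set T)
    (hN : IsPathConnected (ι ⁻¹' N)) {s' : smoothFiberLocus π n} (hs' : ι s' ∈ N) (γ : Path s' s)
    (B : LinearMap.BilinForm ℚ (Motives.bettiCohomology (Motives.fiberOver π s.1) k))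
    (hB : B.Nondegenerate) {m : ℕ} (t : Fin m → localSubgroup ι s N hs' γ)
    (ht : Subgroup.closure (Set.range t) = ⊤)
    (δ : Fin m → Motives.bettiCohomology (Motives.fiberOver π s.1) k) (hδ : ∀ i, δ i ≠ 0)
    (hPL : ∀ (i : Fin m) (x : Motives.bettiCohomology (Motives.fiberOver π s.1) k),
      D.ratMonodromy k s (t i : FundamentalGroup (smoothFiberLocus π n) s) x = x - B x (δ i) • δ i)
    (horth : ∀ i j, B (δ i) (δ j) = 0) :
    localKernelOn ι (D.V k) s N =
      ⨅ (s₂ : smoothFiberLocus π n) (hs₂ : ι s₂ ∈ N) (γ₂ : Path s₂ s),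
        LinearMap.ker (evalCoinvOn (monodromyRepObj (D.V k) s) (localSubgroup ι s N hs₂ γ₂)) := by
  refine localTubeSpan_localKernelOn_eq_iInf_ker_of_rat ι D k s N hN hs' γ ?_
  haveI : FiniteDimensional ℚ
      (Rep.res (localSubgroup ι s N hs' γ).subtype (Rep.of (D.ratMonodromy k s))).V :=
    (localTubeSpan_ratTensorEquiv D k s (D.ratMonodromy k s) (D.ofRatClass_ratMonodromy k s)).1
  exact localTubeSpan_injective_evalCoinv_of_orthogonal_transvections
    (Rep.res (localSubgroup ι s N hs' γ).subtype (Rep.of (D.ratMonodromy k s))) B hB t ht δ hδ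
    (fun i x => hPL i x) horth

/-- **The colimit form at `t₀` from `ℚ`-cyclic detection on small balls.**  If for all sufficiently
small open neighbourhoods `N'` of `t₀` Schnell's third map of the rational monodromy restricted to
every local subgroup at `N'` is injective (e.g. because each carries a presentation of a covered
configuration type), then a class undetected on the local subgroups of SOME neighbourhood of `t₀`
lies in the tree's `localKernel ι (D.V k) s t₀` — the shape `LocalTubeSpanCFree` of the crux's typed
candidate (`…LocalKernelOfBalls`). -/
theorem localTubeSpan_mem_localKernel_of_rat_balls (ι : C(smoothFiberLocus π n, T))
    (D : DirectImageLocalSystem π n) (k : ℕ) (s : smoothFiberLocus π n) (t₀ : T)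
    (hballs : ∃ N₀ ∈ 𝓝 t₀, ∀ N' ∈ 𝓝 t₀, N' ⊆ N₀ → IsOpen N' →
      ∀ (s' : smoothFiberLocus π n) (hs' : ι s' ∈ N') (γ : Path s' s),
        Function.Injective (evalCoinv
          (Rep.res (localSubgroup ι s N' hs' γ).subtype (Rep.of (D.ratMonodromy k s)))))
    (ξ : groupCohomology.H1 (monodromyRepObj (D.V k) s))
    (hξ : ∃ N ∈ 𝓝 t₀, ∀ (s' : smoothFiberLocus π n) (hs' : ι s' ∈ N) (γ : Path s' s),
      evalCoinvOn (monodromyRepObj (D.V k) s) (localSubgroup ι s N hs' γ) ξ = 0) :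
    ξ ∈ localKernel ι (D.V k) s t₀ := by
  obtain ⟨N₀, hN₀, h⟩ := hballs
  exact localTubeSpan_mem_localKernel_of_balls ι (D.V k) s t₀
    ⟨N₀, hN₀, fun N' hN' hsub hopen s' hs' γ =>
      localTubeSpan_ker_evalCoinvOn_eq_H1resKer_of_rat D k s _ (h N' hN' hsub hopen s' hs' γ)⟩ ξ hξ

end Summit.HodgeConjecture.HodgeConjecture.Theorems

end
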